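import Literature.Computability.Cryptography.CubicClassTableLadder
import Literature.Computability.Cryptography.CubicClassTableFPKernel
import Literature.Computability.Cryptography.CubicClassTableFPGens
import Literature.Computability.Complexity.CodeFPInvFolds
import Literature.Computability.Complexity.AmanoMaruokaProofs
import HarnessLib

/-!
# The class-group table on codes, II: the clamped square-and-multiply and the size invariants of `b_e`

Theorem-only sequel of `CubicClassTableFPKernel.lean` (part I: the clamp, `redc`, `starCc`, one round `codeFP_powStep`)
towards the typed polynomial-time computability of the clamped class-group table of `CubicClassTable.lean` /
`CubicClassTableLadder.lean`. This part closes the loop of the clamped square-and-multiply `powCc` (a fold of the round over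
the bit positions `(range ℓe).reverse` with an `Option` accumulator) and states the size invariants of the fold `bEc` over
the generator slots:

* `exists_logBound` — ONE polynomial `K` in the length of the context code bounding the clamp size
  `|ord| + 26 |bin cap| + 38` and the logs of the reduction program at every clamped six-entry code (`< 2^K`), assembled
  from the output-length polynomials of the black boxes (`CodeFP.exists_length_le_eval`, `size_redL_le`; the arithmetic
  `2^a + 2^b ≤ 2^(a+b+1)` is `Complexity.two_pow_add_two_pow_le` of `AmanoMaruokaProofs.lean`);
* `powStep_label`, `powStep_pos`, `powCc_label`, `powCc_pos` — the size invariant of the loop: labels stay clamps of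
  six-entry codes, and after `j` rounds the position `N_j` satisfies `N_j + G ≤ 2^j G`, `G = |pos g| + 2^(K+1)`
  (a squaring doubles the position and adds `< 2^K`, a multiplication adds `|pos g| + 2^K`);
* `length_PLatE_le` — the code of a state with a clamped label and position `≤ 2^j G` is short;
* `codeFP_powCc` — the clamped square-and-multiply is computed on codes (pointwise form), by `CodeFP.foldlInv`;
* `bEcStep_label`, `bEcStep_pos`, `bEc_eq_foldl`, `bEc_label` — the step of `bEc` written through `Option.elim`, its label
  and position invariants (`N + H ≤ 2^j H`, `H = 2^ℓe (M + 2^(K+1)) + 2^K` for `M` bounding the generators' logs).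

## References

* S. Arora, B. Barak, *Computational Complexity: A Modern Approach*, CUP 2009, §1.3. [AroraBarak2009]
* D. E. Knuth, *The Art of Computer Programming*, Vol. 2, 3rd ed., 1998, §4.6.3 (square-and-multiply). [KnuthTAOCP2]
* S. Hallgren, STOC 2005, §4. [Hallgren2005]
-/

namespace Literature.Computability.Cryptography

namespace CubicClassTable

open Literature.Computability.Complexity Literature.Computability.Complexity.CodeFP Polynomial

namespace WalkFns

/-! ### Arithmetic of the size invariants -/

/-- The default code is itself a clamp of a six-entry code (`(cap + 1, [])` fails the cap). [folklore] -/
theorem clampL_capSucc (cap : ℕ) (dflt : Lat) : clampL cap dflt (cap + 1, []) = dflt := by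
  unfold clampL
  rw [if_neg]
  rintro ⟨h, -⟩
  exact absurd h (by simp)

/-- `z ≤ 2^j H ⟹ size z ≤ j + size H`. [folklore] -/
theorem size_le_of_le_two_pow_mul {z j H : ℕ} (h : z ≤ 2 ^ j * H) : z.size ≤ j + H.size :=
  (Nat.size_le_size h).trans (by rw [mul_comm]; exact (IntWalkOps.size_mul_two_pow_le H j).trans (by omega))

/-- **The code of a walk state with a clamped label is short**: with the clamp size `≤ K` and the position
`≤ 2^j G`, `|code| ≤ 2K + 2j + 2 size G + 4`. [folklore] -/
theorem length_PLatE_le {cap K : ℕ} {ord : Lat}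
    (hCl : (pairE natE (rawE intE) ord).length + 26 * (natE cap).length + 38 ≤ K) {x : PLat} {j G : ℕ}
    (hx1 : ∃ y : Lat, y.2.length ≤ 6 ∧ x.1 = clampL cap ord y) (hx2 : x.2.natAbs ≤ 2 ^ j * G) :
    (pairE (pairE natE (rawE intE)) intE x).length ≤ 2 * K + 2 * j + 2 * G.size + 4 := by
  obtain ⟨y, hy, hx⟩ := hx1
  have h1 := length_clampL_le cap ord y hy
  rw [← hx] at h1
  have h2 := (length_intE_le_size x.2).trans (Nat.add_le_add_right (Nat.mul_le_mul_left 2 (size_le_of_le_two_pow_mul hx2)) 2)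
  rw [length_pairE]
  omega

variable (F : WalkFns)

/-! ### The master size bound -/

/-- **One polynomial bounds the clamp size and the logs at clamped codes**: for the reduction program, the walk
instance, the order code and the cap computed on codes from a context `s`, some polynomial `K` in `|code s|` bounds
`|ord| + 26 |bin cap| + 38` and satisfies `|(redL (d, clampL cap ord y)).2| < 2^K` for every six-entry `y`.
[cite: AroraBarak2009, §1.3] -/
theorem exists_logBound {σ : Type} {eσ : σ → List Bool} {I : σ → Inst} {cap : σ → ℕ}
    (hred : CodeFP (pairE (pairE (pairE natE natE) unE) (pairE natE (rawE intE))) (pairE (pairE natE (rawE intE)) intE) F.redL)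
    (hd : CodeFP eσ (pairE (pairE natE natE) unE) (fun s => (I s).d)) (hord : CodeFP eσ (pairE natE (rawE intE)) (fun s => (I s).ord))
    (hcap : CodeFP eσ natE cap) :
    ∃ K : Polynomial ℕ, ∀ s,
      (pairE natE (rawE intE) (I s).ord).length + 26 * (natE (cap s)).length + 38 ≤ K.eval (eσ s).length ∧
      ∀ y : Lat, y.2.length ≤ 6 →
        ((F.redL ((I s).d, clampL (cap s) (I s).ord y)).2).natAbs < 2 ^ K.eval (eσ s).length := by
  obtain ⟨P, hP⟩ := exists_length_le_eval hred
  obtain ⟨Pd, hPd⟩ := exists_length_le_eval hd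
  obtain ⟨Po, hPo⟩ := exists_length_le_eval hord
  obtain ⟨Pc, hPc⟩ := exists_length_le_eval hcap
  refine ⟨P.comp (2 * Pd + Po + 26 * Pc + 40) + Po + 26 * Pc + 38, fun s => ?_⟩
  have h1 := hPd s
  have h2 := hPo s
  have h3 := hPc s
  simp only [eval_add, eval_mul, eval_comp, eval_ofNat]
  refine ⟨by omega, fun y hy => ?_⟩
  have hS := length_clampL_le (cap s) (I s).ord y hy
  have h := (F.size_redL_le (I s).d (clampL (cap s) (I s).ord y) P hP le_rfl hS).2
  refine lt_of_lt_of_le h (Nat.pow_le_pow_right Nat.two_pos ?_)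
  have hm : P.eval (2 * (pairE (pairE natE natE) unE (I s).d).length + 2 +
      ((pairE natE (rawE intE) (I s).ord).length + 26 * (natE (cap s)).length + 38)) ≤
      P.eval (2 * Pd.eval (eσ s).length + Po.eval (eσ s).length + 26 * Pc.eval (eσ s).length + 40) :=
    TM2Iter.eval_mono P (by omega)
  omega

/-! ### The size invariant of the square-and-multiply -/

/-- **Labels along the square-and-multiply stay clamps of six-entry codes.** [folklore] -/
theorem powStep_label (hred6 : ∀ x, ((F.redL x).1).2.length ≤ 6) (I : Inst) (cap : ℕ) (g : PLat)
    (hg1 : ∃ y : Lat, y.2.length ≤ 6 ∧ g.1 = clampL cap I.ord y) (n i : ℕ) (o : Option PLat)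
    (ho : ∀ x, o = some x → ∃ y : Lat, y.2.length ≤ 6 ∧ x.1 = clampL cap I.ord y) :
    ∀ x, (let sq := match o with
        | none => none
        | some x => some (F.starCc I cap x x)
      if Nat.testBit n i then
        match sq with
        | none => some g
        | some x => some (F.starCc I cap x g)
      else sq) = some x → ∃ y : Lat, y.2.length ≤ 6 ∧ x.1 = clampL cap I.ord y := by
  intro x hx
  cases o with
  | none =>
    by_cases hb : Nat.testBit n i = true
    · simp only [hb, if_true, Option.some.injEq] at hx
      rw [← hx]; exact hg1
    · simp only [hb] at hx
      cases hx
  | some z =>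
    by_cases hb : Nat.testBit n i = true
    · simp only [hb, if_true, Option.some.injEq] at hx
      rw [← hx]; exact F.exists_starCc_fst hred6 I cap _ _
    · simp only [hb, Bool.false_eq_true, if_false, Option.some.injEq] at hx
      rw [← hx]; exact F.exists_starCc_fst hred6 I cap _ _

/-- **Positions along the square-and-multiply**: if `N + G ≤ 2^j G` before a round (`G = |pos g| + 2^(K+1)`, the logs
of the reductions `< 2^K`), then `N' + G ≤ 2^(j+1) G` after it. [cite: KnuthTAOCP2, §4.6.3] -/
theorem powStep_pos (hlat6 : ∀ x, (F.latProd x).2.length ≤ 6) (I : Inst) (cap K : ℕ)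
    (hR : ∀ y : Lat, y.2.length ≤ 6 → ((F.redL (I.d, clampL cap I.ord y)).2).natAbs < 2 ^ K) (g : PLat) (n i j : ℕ)
    (o : Option PLat)
    (ho : ∀ x, o = some x → x.2.natAbs + (g.2.natAbs + 2 ^ (K + 1)) ≤ 2 ^ j * (g.2.natAbs + 2 ^ (K + 1))) :
    ∀ x, (let sq := match o with
        | none => none
        | some x => some (F.starCc I cap x x)
      if Nat.testBit n i then
        match sq with
        | none => some g
        | some x => some (F.starCc I cap x g)
      else sq) = some x → x.2.natAbs + (g.2.natAbs + 2 ^ (K + 1)) ≤ 2 ^ (j + 1) * (g.2.natAbs + 2 ^ (K + 1)) := by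
  intro x hx
  have hpow : 2 ^ (j + 1) * (g.2.natAbs + 2 ^ (K + 1)) = 2 * (2 ^ j * (g.2.natAbs + 2 ^ (K + 1))) := by ring
  have hK1 : 2 ^ (K + 1) = 2 * 2 ^ K := by ring
  have hj1 : g.2.natAbs + 2 ^ (K + 1) ≤ 2 ^ j * (g.2.natAbs + 2 ^ (K + 1)) :=
    Nat.le_mul_of_pos_left _ (Nat.pow_pos Nat.two_pos)
  have hst := F.natAbs_starCc_snd_le hlat6 I cap K hR
  cases o with
  | none =>
    by_cases hb : Nat.testBit n i = true
    · simp only [hb, if_true, Option.some.injEq] at hx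
      rw [← hx]; omega
    · simp only [hb] at hx
      cases hx
  | some z =>
    have hz := ho z rfl
    have h1 := hst z z
    by_cases hb : Nat.testBit n i = true
    · simp only [hb, if_true, Option.some.injEq] at hx
      rw [← hx]
      have h2 := hst (F.starCc I cap z z) g
      omega
    · simp only [hb, Bool.false_eq_true, if_false, Option.some.injEq] at hx
      rw [← hx]; omega

/-- **Labels of the clamped square-and-multiply are clamps of six-entry codes.** [folklore] -/
theorem powCc_label (hred6 : ∀ x, ((F.redL x).1).2.length ≤ 6) (I : Inst) (cap : ℕ) (g : PLat)
    (hg1 : ∃ y : Lat, y.2.length ≤ 6 ∧ g.1 = clampL cap I.ord y) (n : ℕ) :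
    ∀ x, F.powCc I cap g n = some x → ∃ y : Lat, y.2.length ≤ 6 ∧ x.1 = clampL cap I.ord y := by
  unfold powCc
  induction (List.range I.ℓe).reverse using List.reverseRecOn with
  | nil => intro x hx; cases hx
  | append_singleton l i ih =>
    rw [List.foldl_append, List.foldl_cons, List.foldl_nil]
    exact F.powStep_label hred6 I cap g hg1 n i _ ih

/-- **Positions of the clamped square-and-multiply**: `|pos (powCc g n)| + G ≤ 2^ℓe G`, `G = |pos g| + 2^(K+1)`.
[cite: KnuthTAOCP2, §4.6.3] -/
theorem powCc_pos (hlat6 : ∀ x, (F.latProd x).2.length ≤ 6) (I : Inst) (cap K : ℕ)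
    (hR : ∀ y : Lat, y.2.length ≤ 6 → ((F.redL (I.d, clampL cap I.ord y)).2).natAbs < 2 ^ K) (g : PLat) (n : ℕ) :
    ∀ x, F.powCc I cap g n = some x → x.2.natAbs + (g.2.natAbs + 2 ^ (K + 1)) ≤ 2 ^ I.ℓe * (g.2.natAbs + 2 ^ (K + 1)) := by
  have key : ∀ l : List ℕ, ∀ x, (l.foldl (fun acc i =>
      let sq := match acc with
        | none => none
        | some x => some (F.starCc I cap x x)
      if Nat.testBit n i then
        match sq with
        | none => some g
        | some x => some (F.starCc I cap x g)
      else sq) none) = some x → x.2.natAbs + (g.2.natAbs + 2 ^ (K + 1)) ≤ 2 ^ l.length * (g.2.natAbs + 2 ^ (K + 1)) := by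
    intro l
    induction l using List.reverseRecOn with
    | nil => intro x hx; cases hx
    | append_singleton l i ih =>
      rw [List.foldl_append, List.foldl_cons, List.foldl_nil, List.length_append, List.length_singleton]
      exact F.powStep_pos hlat6 I cap K hR g n i _ _ ih
  have h := key (List.range I.ℓe).reverse
  rw [List.length_reverse, List.length_range] at h
  exact h

/-! ### The clamped square-and-multiply on codes -/

/-- **The clamped square-and-multiply is computed on codes** (pointwise form; the base `g` computed from the context
with a clamped label, the exponent binary, `ℓe` unary): a fold of `codeFP_powStep` over `(range ℓe).reverse` whose
accumulator stays short by `powStep_label` / `powStep_pos`. [cite: AroraBarak2009, §1.3; KnuthTAOCP2, §4.6.3] -/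
theorem codeFP_powCc {σ : Type} {eσ : σ → List Bool} {I : σ → Inst} {cap : σ → ℕ} {g : σ → PLat} {n : σ → ℕ}
    (hlat : CodeFP (pairE (pairE natE natE) (pairE (pairE natE (rawE intE)) (pairE natE (rawE intE)))) (pairE natE (rawE intE)) F.latProd) (hred : CodeFP (pairE (pairE (pairE natE natE) unE) (pairE natE (rawE intE))) (pairE (pairE natE (rawE intE)) intE) F.redL)
    (hlat6 : ∀ x, (F.latProd x).2.length ≤ 6) (hred6 : ∀ x, ((F.redL x).1).2.length ≤ 6)
    (hd : CodeFP eσ (pairE (pairE natE natE) unE) (fun s => (I s).d)) (hord : CodeFP eσ (pairE natE (rawE intE)) (fun s => (I s).ord))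
    (hcap : CodeFP eσ natE cap) (hℓe : CodeFP eσ unE (fun s => (I s).ℓe))
    (hg : CodeFP eσ (pairE (pairE natE (rawE intE)) intE) g)
    (hg1 : ∀ s, ∃ y : Lat, y.2.length ≤ 6 ∧ (g s).1 = clampL (cap s) (I s).ord y) (hn : CodeFP eσ natE n) :
    CodeFP eσ (optE (pairE (pairE natE (rawE intE)) intE)) (fun s => F.powCc (I s) (cap s) (g s) (n s)) := by
  obtain ⟨K, hK⟩ := F.exists_logBound hred hd hord hcap
  obtain ⟨Pg, hPg⟩ := exists_length_le_eval hg
  -- the round, context `(s, (i, acc))`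
  have hstep := F.codeFP_powStep (σ := σ × (ℕ × Option PLat))
    (eσ := pairE eσ (pairE natE (optE (pairE (pairE natE (rawE intE)) intE))))
    (I := fun t => I t.1) (cap := fun t => cap t.1) (g := fun t => g t.1) (n := fun t => n t.1) (i := fun t => t.2.1)
    (acc := fun t => t.2.2) hlat hred (hd.comp (fst _ _)) (hord.comp (fst _ _)) (hcap.comp (fst _ _)) (hg.comp (fst _ _))
    (hn.comp (fst _ _)) (snd _ _).fst' (snd _ _).snd'
  have hl : CodeFP eσ (rawE natE) (fun s => (List.range (I s).ℓe).reverse) := ((rawReverse natE).comp (urange.comp hℓe) :)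
  -- size of `G = |pos g| + 2^(K+1)`
  have hG : ∀ s, ((g s).2.natAbs + 2 ^ (K.eval (eσ s).length + 1)).size ≤ Pg.eval (eσ s).length + K.eval (eσ s).length + 3 := by
    intro s
    have h1 : (g s).2.natAbs < 2 ^ Pg.eval (eσ s).length := by
      refine lt_of_lt_of_le (IntWalkOps.natAbs_lt_two_pow_length _) (Nat.pow_le_pow_right Nat.two_pos ?_)
      refine le_trans ?_ (hPg s)
      rw [length_pairE]; omega
    refine Nat.size_le.2 (lt_of_lt_of_le (Nat.add_lt_add_right h1 _) ?_)
    exact (two_pow_add_two_pow_le _ _).trans (Nat.pow_le_pow_right Nat.two_pos (by omega))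
  have h := foldlInv (eσ := eσ) (eα := natE) (eβ := optE (pairE (pairE natE (rawE intE)) intE))
    (step := fun s i acc =>
      let sq := match acc with
        | none => none
        | some x => some (F.starCc (I s) (cap s) x x)
      if Nat.testBit (n s) i then
        match sq with
        | none => some (g s)
        | some x => some (F.starCc (I s) (cap s) x (g s))
      else sq)
    (init := fun _ => none) (l := fun s => (List.range (I s).ℓe).reverse)
    (fun s j o => ∀ x, o = some x → (∃ y : Lat, y.2.length ≤ 6 ∧ x.1 = clampL (cap s) (I s).ord y) ∧
      x.2.natAbs + ((g s).2.natAbs + 2 ^ (K.eval (eσ s).length + 1)) ≤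
        2 ^ j * ((g s).2.natAbs + 2 ^ (K.eval (eσ s).length + 1)))
    hstep (const eσ none) hl (fun _ x hx => by cases hx)
    (fun s j i o ho => fun x hx =>
      ⟨F.powStep_label hred6 (I s) (cap s) (g s) (hg1 s) (n s) i o (fun x hx => (ho x hx).1) x hx,
        F.powStep_pos hlat6 (I s) (cap s) _ (hK s).2 (g s) (n s) i j o (fun x hx => (ho x hx).2) x hx⟩)
    (8 * K + 4 * Pg + 4 * X + 22)
    (fun s j o ho => by
      cases o with
      | none => exact Nat.zero_le _
      | some x =>
        obtain ⟨hx1, hx2⟩ := ho x rfl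
        rw [length_optE_some]
        have hlen := length_PLatE_le (hK s).1 hx1 (le_trans (Nat.le_add_right _ _) hx2)
        have hGs := hG s
        have hm1 : K.eval (eσ s).length ≤ K.eval ((eσ s).length + j) := TM2Iter.eval_mono K (by omega)
        have hm2 : Pg.eval (eσ s).length ≤ Pg.eval ((eσ s).length + j) := TM2Iter.eval_mono Pg (by omega)
        simp only [eval_add, eval_mul, eval_ofNat, eval_X]
        omega)
  exact h.congr fun s => rfl

/-! ### The size invariant of the fold over the generator slots -/

/-- **Labels along `bEc` stay clamps of six-entry codes** (the step written with `Option.elim`; `bEc_eq_foldl`).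
[folklore] -/
theorem bEcStep_label (hred6 : ∀ x, ((F.redL x).1).2.length ≤ 6) (I : Inst) (cap v t : ℕ) (o : Option PLat)
    (ho : ∀ x, o = some x → ∃ y : Lat, y.2.length ≤ 6 ∧ x.1 = clampL cap I.ord y) :
    ∀ x, (F.powCc I cap (F.redc I cap (F.gT I v t)) (I.digit v t)).elim o
      (fun x => o.elim (some x) fun y => some (F.starCc I cap y x)) = some x → ∃ y : Lat, y.2.length ≤ 6 ∧ x.1 = clampL cap I.ord y := by
  rcases hr : F.powCc I cap (F.redc I cap (F.gT I v t)) (I.digit v t) with _ | x' <;> intro x hx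
  · exact ho x hx
  · cases o with
    | none =>
      simp only [Option.elim, Option.some.injEq] at hx
      rw [← hx]
      exact F.powCc_label hred6 I cap _ ⟨_, hred6 _, rfl⟩ _ x' hr
    | some y =>
      simp only [Option.elim, Option.some.injEq] at hx
      rw [← hx]
      exact F.exists_starCc_fst hred6 I cap _ _

/-- **Positions along `bEc`**: with `H = 2^ℓe (M + 2^(K+1)) + 2^K` (`M` bounding the logs at the generator slots), if
`N + H ≤ 2^j H` before a slot then `N' + H ≤ 2^(j+1) H` after it. [cite: Hallgren2005, §4] -/
theorem bEcStep_pos (hlat6 : ∀ x, (F.latProd x).2.length ≤ 6) (I : Inst) (cap K : ℕ)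
    (hR : ∀ y : Lat, y.2.length ≤ 6 → ((F.redL (I.d, clampL cap I.ord y)).2).natAbs < 2 ^ K) (v M : ℕ)
    (hM : ∀ t, ((F.redL (I.d, F.gT I v t)).2).natAbs ≤ M) (t j : ℕ) (o : Option PLat)
    (ho : ∀ x, o = some x → x.2.natAbs + (2 ^ I.ℓe * (M + 2 ^ (K + 1)) + 2 ^ K) ≤ 2 ^ j * (2 ^ I.ℓe * (M + 2 ^ (K + 1)) + 2 ^ K)) :
    ∀ x, (F.powCc I cap (F.redc I cap (F.gT I v t)) (I.digit v t)).elim o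
      (fun x => o.elim (some x) fun y => some (F.starCc I cap y x)) = some x →
      x.2.natAbs + (2 ^ I.ℓe * (M + 2 ^ (K + 1)) + 2 ^ K) ≤ 2 ^ (j + 1) * (2 ^ I.ℓe * (M + 2 ^ (K + 1)) + 2 ^ K) := by
  have hpow : 2 ^ (j + 1) * (2 ^ I.ℓe * (M + 2 ^ (K + 1)) + 2 ^ K) = 2 * (2 ^ j * (2 ^ I.ℓe * (M + 2 ^ (K + 1)) + 2 ^ K)) := by ring
  have hj1 : 2 ^ I.ℓe * (M + 2 ^ (K + 1)) + 2 ^ K ≤ 2 ^ j * (2 ^ I.ℓe * (M + 2 ^ (K + 1)) + 2 ^ K) :=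
    Nat.le_mul_of_pos_left _ (Nat.pow_pos Nat.two_pos)
  have hst := F.natAbs_starCc_snd_le hlat6 I cap K hR
  rcases hr : F.powCc I cap (F.redc I cap (F.gT I v t)) (I.digit v t) with _ | x' <;> intro x hx
  · have h4 := ho x hx
    rw [hpow]
    generalize 2 ^ j * (2 ^ I.ℓe * (M + 2 ^ (K + 1)) + 2 ^ K) = A at *
    generalize 2 ^ I.ℓe * (M + 2 ^ (K + 1)) + 2 ^ K = H at *
    omega
  · have hx' : x'.2.natAbs ≤ 2 ^ I.ℓe * (M + 2 ^ (K + 1)) := by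
      have h1 := F.powCc_pos hlat6 I cap K hR (F.redc I cap (F.gT I v t)) _ x' hr
      have h2 : (F.redc I cap (F.gT I v t)).2.natAbs ≤ M := hM t
      exact le_trans (le_trans (Nat.le_add_right _ _) h1) (Nat.mul_le_mul_left _ (by omega))
    cases o with
    | none =>
      simp only [Option.elim, Option.some.injEq] at hx
      rw [← hx, hpow]
      generalize 2 ^ j * (2 ^ I.ℓe * (M + 2 ^ (K + 1)) + 2 ^ K) = A at *
      generalize 2 ^ I.ℓe * (M + 2 ^ (K + 1)) = B at *
      generalize 2 ^ K = C at *
      omega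
    | some y =>
      simp only [Option.elim, Option.some.injEq] at hx
      have h3 := hst y x'
      have h4 := ho y rfl
      rw [← hx, hpow]
      generalize 2 ^ j * (2 ^ I.ℓe * (M + 2 ^ (K + 1)) + 2 ^ K) = A at *
      generalize 2 ^ I.ℓe * (M + 2 ^ (K + 1)) = B at *
      generalize 2 ^ K = C at *
      omega

/-- `bEc` with its step written through `Option.elim` (the form the size invariants are stated for). [folklore] -/
theorem bEc_eq_foldl (I : Inst) (cap v : ℕ) :
    F.bEc I cap v = ((List.range I.T).foldl (fun acc t => (F.powCc I cap (F.redc I cap (F.gT I v t)) (I.digit v t)).elim acc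
      (fun x => acc.elim (some x) fun y => some (F.starCc I cap y x))) none).getD (I.ord, 0) := by
  unfold bEc
  congr 1
  refine List.foldl_ext _ _ _ fun acc t _ => ?_
  rcases F.powCc I cap (F.redc I cap (F.gT I v t)) (I.digit v t) with _ | x <;> rcases acc with _ | y <;> rfl

/-- **The label of `b_e` (clamped) is a clamp of a six-entry code.** [folklore] -/
theorem bEc_label (hred6 : ∀ x, ((F.redL x).1).2.length ≤ 6) (I : Inst) (cap v : ℕ) :
    ∃ y : Lat, y.2.length ≤ 6 ∧ (F.bEc I cap v).1 = clampL cap I.ord y := by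
  have key : ∀ l : List ℕ, ∀ x, (l.foldl (fun acc t => (F.powCc I cap (F.redc I cap (F.gT I v t)) (I.digit v t)).elim acc
      (fun x => acc.elim (some x) fun y => some (F.starCc I cap y x))) none) = some x →
      ∃ y : Lat, y.2.length ≤ 6 ∧ x.1 = clampL cap I.ord y := by
    intro l
    induction l using List.reverseRecOn with
    | nil => intro x hx; cases hx
    | append_singleton l t ih =>
      rw [List.foldl_append, List.foldl_cons, List.foldl_nil]
      exact F.bEcStep_label hred6 I cap v t _ ih
  have key2 : ∀ o : Option PLat, (∀ x, o = some x → ∃ y : Lat, y.2.length ≤ 6 ∧ x.1 = clampL cap I.ord y) →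
      ∃ y : Lat, y.2.length ≤ 6 ∧ (o.getD (I.ord, 0)).1 = clampL cap I.ord y := by
    intro o ho
    cases o with
    | none => exact ⟨(cap + 1, []), by simp, (clampL_capSucc cap I.ord).symm⟩
    | some x => exact ho x rfl
  rw [bEc_eq_foldl]
  exact key2 _ (key _)

end WalkFns

end CubicClassTable

end Literature.Computability.Cryptography
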